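import Mathlib.RepresentationTheory.Basic
import Mathlib.LinearAlgebra.Prod
import HarnessLib

/-!
# Extensions of representations from Hom-valued 1-cocycles: existence, «split ⟺ coboundary», shears, functoriality («COCYCLE-EXTENSION»)

Generic representation theory over a commutative ring `k` (any monoid `G`), Mathlib-only (`Representation k G _`), THEOREMS ONLY
(no `def`, no instance, no named fact).

THE SITUATION.  `ρ : Representation k G U`, `ρ' : Representation k G U'` and a HOM-VALUED 1-COCYCLE `c : G → (U' →ₗ[k] U)`:
`c 1 = 0`, `c (g h) = ρ g ∘ c h + c g ∘ ρ' h`.  The block-triangular operators `E g (u, u') = (ρ g u + c g u', ρ' g u')` on `U × U'` form a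
representation — the EXTENSION `0 → (U, ρ) → E_c → (U', ρ') → 0` attached to `c` (sub `U × 0`, quotient `snd`).  Every extension with a
`k`-linear splitting of `snd` is of this form, which is how the consumers meet it.

* §1 `exists_representation_of_cocycle` (existence of `E_c`), the sub and quotient maps (`cocycleRep_apply_left`, `snd_cocycleRep_apply`).
* §2 **SPLIT ⟺ COBOUNDARY** (`exists_equivariant_graph_iff_coboundary`): `E_c` has an equivariant section of `snd` — necessarily a graph
  `u' ↦ (t u', u')` (`equivariant_section_eq_graph`) — iff `c g = t ∘ ρ' g - ρ g ∘ t` for some `t : U' →ₗ U`.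
* §3 SHEARS: changing `c` by the coboundary of `t` is conjugation by the shear `(u, u') ↦ (u + t u', u')` (`shear_conj_cocycleRep`), so
  cohomologous cocycles give isomorphic extensions; in particular a coboundary gives `E ≅ ρ ⊕ ρ'`.
* §4 FUNCTORIALITY: pull-back along an equivariant `f : U'' → U'` (cocycle `c g ∘ f`, map `(u, u'') ↦ (u, f u'')`) and push-out along an
  equivariant `e : U → U'''` (cocycle `e ∘ c g`, map `(u, u') ↦ (e u, u')`) — `pullback_isCocycle`, `cocycleRep_pullback_map`,
  `pushout_isCocycle`, `cocycleRep_pushout_map`; coboundaries go to coboundaries (`pullback_coboundary`, `pushout_coboundary`).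

SPECIAL CASES already in the tree (cited, not restated): `U' = k` with `ρ'` a character — the derivation `D_u g = c g 1` of
`CharacterExtensionCocycle` («split ⟺ principal»); `U = U'`, `ρ = ρ'`, `c = π₁` — the jet module of `FirstOrderJetIntertwiner` (whose §4
exhibits a cocycle block as a coboundary; §2 here turns that into an actual splitting).

SOURCES (what is formalised, read at our letters).  K. S. Brown, *Cohomology of Groups* (GTM 87), Ch. IV §2 pp. 87–89 (Prop. 2.1: split
extensions = semi-direct products; splittings ↔ derivations `d(gh) = dg + g·dh`; conjugate splittings ↔ principal derivations; Prop. 2.3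
p. 89: classes ↔ `H¹`) and Ch. III §1 Ex. 2 p. 60 (`H¹ = Der ∕ P`) — read for `k[G]`-MODULE extensions with a `k`-linear splitting: the
deviation of the splitting from equivariance is a derivation of `G` into the bimodule `Hom_k(U', U)` (left action through `ρ`, right through
`ρ'`), i.e. our cocycle identity; a change of splitting is a shear and changes `c` by a principal derivation (§3); an equivariant splitting
exists iff the class vanishes (§2).  Deliberately NOT here: `Ext¹`∕`H¹` as objects (Mathlib's `groupCohomology` is not needed by the
consumers, who hold explicit block matrices), topology, and anything specific to the groups where this is applied.
-/

set_option autoImplicit false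

namespace Literature.RepresentationTheory

variable {k : Type*} [CommRing k] {G : Type*} [Monoid G]
variable {U U' : Type*} [AddCommGroup U] [Module k U] [AddCommGroup U'] [Module k U']

/-! ## §1 The extension attached to a Hom-valued 1-cocycle -/

/-- **EXISTENCE OF `E_c`.**  For representations `ρ, ρ'` on `U, U'` and a Hom-valued 1-cocycle `c` (`c 1 = 0`,
`c (g h) = ρ g ∘ c h + c g ∘ ρ' h`) there is a representation of `G` on `U × U'` acting by `(u, u') ↦ (ρ g u + c g u', ρ' g u')`.
[cite: Brown1982, Ch. IV §2 Prop. 2.1 p. 87] [cite: Brown1982, Ch. IV §2 pp. 88–89] -/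
theorem exists_representation_of_cocycle (ρ : Representation k G U) (ρ' : Representation k G U') (c : G → U' →ₗ[k] U)
    (h1 : c 1 = 0) (hc : ∀ g h, c (g * h) = ρ g ∘ₗ c h + c g ∘ₗ ρ' h) :
    ∃ E : Representation k G (U × U'), ∀ g u u', E g (u, u') = (ρ g u + c g u', ρ' g u') := by
  let M : G → (U × U') →ₗ[k] (U × U') := fun g =>
    LinearMap.prod (ρ g ∘ₗ LinearMap.fst k U U' + c g ∘ₗ LinearMap.snd k U U') (ρ' g ∘ₗ LinearMap.snd k U U')
  have hM : ∀ g u u', M g (u, u') = (ρ g u + c g u', ρ' g u') := fun g u u' => rfl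
  refine ⟨{ toFun := M, map_one' := ?_, map_mul' := fun g h => ?_ }, fun g u u' => rfl⟩
  · apply LinearMap.ext
    rintro ⟨u, u'⟩
    rw [hM, map_one, map_one, h1, Module.End.one_apply, Module.End.one_apply, LinearMap.zero_apply, add_zero,
      Module.End.one_apply]
  · apply LinearMap.ext
    rintro ⟨u, u'⟩
    rw [Module.End.mul_apply, hM, hM, hM, map_mul, map_mul, hc, Module.End.mul_apply, Module.End.mul_apply]
    refine Prod.ext ?_ rfl
    simp only [LinearMap.add_apply, LinearMap.comp_apply, map_add]
    abel

/-- The SUB `U × 0` is a copy of `(U, ρ)`: `E g (u, 0) = (ρ g u, 0)`. [cite: Brown1982, Ch. IV §2 Prop. 2.1 p. 87] -/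
theorem cocycleRep_apply_left (ρ : Representation k G U) (ρ' : Representation k G U') (c : G → U' →ₗ[k] U)
    (E : Representation k G (U × U')) (hE : ∀ g u u', E g (u, u') = (ρ g u + c g u', ρ' g u')) (g : G) (u : U) :
    E g (u, 0) = (ρ g u, 0) := by
  rw [hE, map_zero, map_zero, add_zero]

/-- The QUOTIENT map `snd` is equivariant onto `(U', ρ')`: `(E g x).2 = ρ' g x.2`. [cite: Brown1982, Ch. IV §2 Prop. 2.1 p. 87] -/
theorem snd_cocycleRep_apply (ρ : Representation k G U) (ρ' : Representation k G U') (c : G → U' →ₗ[k] U)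
    (E : Representation k G (U × U')) (hE : ∀ g u u', E g (u, u') = (ρ g u + c g u', ρ' g u')) (g : G) (x : U × U') :
    (E g x).2 = ρ' g x.2 := by
  obtain ⟨u, u'⟩ := x
  rw [hE]

/-- The cocycle identity forces `c 1 = 0` whenever `ρ 1 = 1` acts (it does): `c 1 = ρ 1 ∘ c 1 + c 1 ∘ ρ' 1 = 2 c 1`; we keep `c 1 = 0` as an
explicit hypothesis in §1 and record here that it FOLLOWS from the identity. [cite: Brown1982, Ch. IV §2 Exercise 1 p. 89] -/
theorem cocycle_one_eq_zero (ρ : Representation k G U) (ρ' : Representation k G U') (c : G → U' →ₗ[k] U)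
    (hc : ∀ g h, c (g * h) = ρ g ∘ₗ c h + c g ∘ₗ ρ' h) : c 1 = 0 := by
  have h := hc 1 1
  rw [mul_one, map_one, map_one] at h
  -- h : c 1 = 1 ∘ₗ c 1 + c 1 ∘ₗ 1
  have h' : c 1 = c 1 + c 1 := by
    conv_lhs => rw [h]
    rfl
  exact left_eq_add.mp h'

/-! ## §2 Split ⟺ coboundary -/

/-- Any `k`-linear section of `snd` that is EQUIVARIANT is the graph of its first component: if `(s u').2 = u'` then `s u' = ((fst ∘ s) u', u')`.
(Bookkeeping: so «an equivariant section exists» is the same as «an equivariant GRAPH exists».) [cite: Brown1982, Ch. IV §2 pp. 88–89] -/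
theorem section_eq_graph (s : U' →ₗ[k] (U × U')) (hs : ∀ u', (s u').2 = u') (u' : U') :
    s u' = ((LinearMap.fst k U U' ∘ₗ s) u', u') := by
  refine Prod.ext rfl ?_
  rw [hs]

/-- **THE GRAPH OF `t` IS EQUIVARIANT ⟺ `c` IS THE COBOUNDARY OF `t`.**  For the extension `E_c` and a `k`-linear `t : U' → U`:
`E g (t u', u') = (t (ρ' g u'), ρ' g u')` for all `g, u'` iff `c g = t ∘ ρ' g - ρ g ∘ t` for all `g`.
[cite: Brown1982, Ch. IV §2 pp. 88–89] -/
theorem graph_equivariant_iff_coboundary (ρ : Representation k G U) (ρ' : Representation k G U') (c : G → U' →ₗ[k] U)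
    (E : Representation k G (U × U')) (hE : ∀ g u u', E g (u, u') = (ρ g u + c g u', ρ' g u')) (t : U' →ₗ[k] U) :
    (∀ g u', E g (t u', u') = (t (ρ' g u'), ρ' g u')) ↔ ∀ g, c g = t ∘ₗ ρ' g - ρ g ∘ₗ t := by
  constructor
  · intro H g
    ext u'
    have h := congrArg Prod.fst (H g u')
    rw [hE] at h
    dsimp only at h
    -- h : ρ g (t u') + c g u' = t (ρ' g u')
    rw [LinearMap.sub_apply, LinearMap.comp_apply, LinearMap.comp_apply, ← h]
    abel
  · intro H g u'
    rw [hE]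
    refine Prod.ext ?_ rfl
    have h := congrArg (fun f : U' →ₗ[k] U => f u') (H g)
    simp only [LinearMap.sub_apply, LinearMap.comp_apply] at h
    -- h : c g u' = t (ρ' g u') - ρ g (t u')
    dsimp only
    rw [h]
    abel

/-- **SPLIT ⟺ COBOUNDARY.**  `E_c` admits an EQUIVARIANT `k`-linear section of `snd` iff `c` is a coboundary:
`(∃ s, snd ∘ s = id ∧ s equivariant) ↔ ∃ t, ∀ g, c g = t ∘ ρ' g - ρ g ∘ t`. [cite: Brown1982, Ch. IV §2 Prop. 2.3 p. 89]
[cite: Brown1982, Ch. III §1 Exercise 2 p. 60] -/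
theorem exists_equivariant_section_iff_coboundary (ρ : Representation k G U) (ρ' : Representation k G U')
    (c : G → U' →ₗ[k] U) (E : Representation k G (U × U')) (hE : ∀ g u u', E g (u, u') = (ρ g u + c g u', ρ' g u')) :
    (∃ s : U' →ₗ[k] (U × U'), (∀ u', (s u').2 = u') ∧ ∀ g u', E g (s u') = s (ρ' g u')) ↔
      ∃ t : U' →ₗ[k] U, ∀ g, c g = t ∘ₗ ρ' g - ρ g ∘ₗ t := by
  constructor
  · rintro ⟨s, hs, hequiv⟩
    refine ⟨LinearMap.fst k U U' ∘ₗ s, (graph_equivariant_iff_coboundary ρ ρ' c E hE _).mp fun g u' => ?_⟩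
    have h := hequiv g u'
    rw [section_eq_graph s hs u', section_eq_graph s hs (ρ' g u')] at h
    exact h
  · rintro ⟨t, ht⟩
    refine ⟨LinearMap.prod t LinearMap.id, fun u' => rfl, fun g u' => ?_⟩
    change E g (t u', u') = (t (ρ' g u'), ρ' g u')
    exact (graph_equivariant_iff_coboundary ρ ρ' c E hE t).mpr ht g u'

/-- In particular the ZERO cocycle gives the direct sum: `u' ↦ (0, u')` is an equivariant section.
[cite: Brown1982, Ch. IV §2 Prop. 2.1 p. 87] -/
theorem zero_graph_equivariant (ρ : Representation k G U) (ρ' : Representation k G U') (E : Representation k G (U × U'))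
    (hE : ∀ g u u', E g (u, u') = (ρ g u + (0 : U' →ₗ[k] U) u', ρ' g u')) (g : G) (u' : U') :
    E g (0, u') = (0, ρ' g u') := by
  rw [hE, map_zero, LinearMap.zero_apply, add_zero]

/-! ## §3 Shears: cohomologous cocycles give conjugate extensions -/

/-- **SHEAR CONJUGATION.**  If `E` is the extension of `c` and `E'` that of `c + δt`, `(δt) g = t ∘ ρ' g - ρ g ∘ t`, then the shear
`S (u, u') = (u + t u', u')` intertwines: `E' g (S x) = S (E g x)`.  So cohomologous cocycles give isomorphic extensions (`S` is invertible
with inverse the shear of `-t`), and a coboundary gives `E ≅ ρ ⊕ ρ'`. [cite: Brown1982, Ch. IV §2 p. 89 (conjugate splittings ↔ principal derivations)] -/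
theorem shear_conj_cocycleRep (ρ : Representation k G U) (ρ' : Representation k G U') (c : G → U' →ₗ[k] U) (t : U' →ₗ[k] U)
    (E E' : Representation k G (U × U')) (hE : ∀ g u u', E g (u, u') = (ρ g u + c g u', ρ' g u'))
    (hE' : ∀ g u u', E' g (u, u') = (ρ g u + (c g + (t ∘ₗ ρ' g - ρ g ∘ₗ t)) u', ρ' g u')) (g : G) (u : U) (u' : U') :
    E' g (u + t u', u') = ((E g (u, u')).1 + t (E g (u, u')).2, (E g (u, u')).2) := by
  rw [hE', hE]
  refine Prod.ext ?_ rfl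
  simp only [LinearMap.add_apply, LinearMap.sub_apply, LinearMap.comp_apply, map_add]
  abel

/-- The shear is a `k`-linear automorphism of `U × U'`: `(u, u') ↦ (u + t u', u')` has inverse `(u, u') ↦ (u - t u', u')` (both directions).
[cite: Brown1982, Ch. IV §2 p. 89] -/
theorem shear_shear_neg (t : U' →ₗ[k] U) (u : U) (u' : U') :
    ((u + t u') + (-t) u', u') = (u, u') ∧ ((u + (-t) u') + t u', u') = (u, u') := by
  constructor <;> refine Prod.ext ?_ rfl <;> simp only [LinearMap.neg_apply] <;> abel

/-! ## §4 Functoriality: pull-back and push-out of cocycles -/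

section Functorial

variable {U'' U''' : Type*} [AddCommGroup U''] [Module k U''] [AddCommGroup U'''] [Module k U''']

/-- **PULL-BACK.**  If `f : U'' → U'` intertwines `ρ''` with `ρ'` then `g ↦ c g ∘ f` is a 1-cocycle for `(ρ, ρ'')`.
[cite: Brown1982, Ch. IV §2 pp. 88–89] -/
theorem pullback_isCocycle (ρ : Representation k G U) (ρ' : Representation k G U') (ρ'' : Representation k G U'')
    (c : G → U' →ₗ[k] U) (hc : ∀ g h, c (g * h) = ρ g ∘ₗ c h + c g ∘ₗ ρ' h) (f : U'' →ₗ[k] U')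
    (hf : ∀ g, ρ' g ∘ₗ f = f ∘ₗ ρ'' g) (g h : G) :
    c (g * h) ∘ₗ f = ρ g ∘ₗ (c h ∘ₗ f) + (c g ∘ₗ f) ∘ₗ ρ'' h := by
  rw [hc, LinearMap.add_comp]
  simp only [LinearMap.comp_assoc, hf]

/-- The pull-back map `(u, u'') ↦ (u, f u'')` intertwines the extension of `c ∘ f` with the extension of `c`.
[cite: Brown1982, Ch. IV §2 pp. 88–89] -/
theorem cocycleRep_pullback_map (ρ : Representation k G U) (ρ' : Representation k G U') (ρ'' : Representation k G U'')
    (c : G → U' →ₗ[k] U) (f : U'' →ₗ[k] U') (hf : ∀ g, ρ' g ∘ₗ f = f ∘ₗ ρ'' g)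
    (E : Representation k G (U × U')) (hE : ∀ g u u', E g (u, u') = (ρ g u + c g u', ρ' g u'))
    (E'' : Representation k G (U × U'')) (hE'' : ∀ g u u'', E'' g (u, u'') = (ρ g u + (c g ∘ₗ f) u'', ρ'' g u'')) (g : G)
    (u : U) (u'' : U'') :
    E g (u, f u'') = ((E'' g (u, u'')).1, f (E'' g (u, u'')).2) := by
  rw [hE, hE'']
  refine Prod.ext rfl ?_
  have h := congrArg (fun T : U'' →ₗ[k] U' => T u'') (hf g)
  simpa only [LinearMap.comp_apply] using h

/-- Pull-back takes coboundaries to coboundaries: `(t ∘ ρ' g - ρ g ∘ t) ∘ f = (t ∘ f) ∘ ρ'' g - ρ g ∘ (t ∘ f)`.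
[cite: Brown1982, Ch. IV §2 p. 89] -/
theorem pullback_coboundary (ρ : Representation k G U) (ρ' : Representation k G U') (ρ'' : Representation k G U'')
    (t : U' →ₗ[k] U) (f : U'' →ₗ[k] U') (hf : ∀ g, ρ' g ∘ₗ f = f ∘ₗ ρ'' g) (g : G) :
    (t ∘ₗ ρ' g - ρ g ∘ₗ t) ∘ₗ f = (t ∘ₗ f) ∘ₗ ρ'' g - ρ g ∘ₗ (t ∘ₗ f) := by
  rw [LinearMap.sub_comp, LinearMap.comp_assoc, hf, LinearMap.comp_assoc, LinearMap.comp_assoc]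

/-- **PUSH-OUT.**  If `e : U → U'''` intertwines `ρ` with `ρ'''` then `g ↦ e ∘ c g` is a 1-cocycle for `(ρ''', ρ')`.
[cite: Brown1982, Ch. IV §2 pp. 88–89] -/
theorem pushout_isCocycle (ρ : Representation k G U) (ρ' : Representation k G U') (ρ''' : Representation k G U''')
    (c : G → U' →ₗ[k] U) (hc : ∀ g h, c (g * h) = ρ g ∘ₗ c h + c g ∘ₗ ρ' h) (e : U →ₗ[k] U''')
    (he : ∀ g, e ∘ₗ ρ g = ρ''' g ∘ₗ e) (g h : G) :
    e ∘ₗ c (g * h) = ρ''' g ∘ₗ (e ∘ₗ c h) + (e ∘ₗ c g) ∘ₗ ρ' h := by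
  rw [hc, LinearMap.comp_add, ← LinearMap.comp_assoc, he, LinearMap.comp_assoc, LinearMap.comp_assoc]

/-- The push-out map `(u, u') ↦ (e u, u')` intertwines the extension of `c` with the extension of `e ∘ c`.
[cite: Brown1982, Ch. IV §2 pp. 88–89] -/
theorem cocycleRep_pushout_map (ρ : Representation k G U) (ρ' : Representation k G U') (ρ''' : Representation k G U''')
    (c : G → U' →ₗ[k] U) (e : U →ₗ[k] U''') (he : ∀ g, e ∘ₗ ρ g = ρ''' g ∘ₗ e)
    (E : Representation k G (U × U')) (hE : ∀ g u u', E g (u, u') = (ρ g u + c g u', ρ' g u'))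
    (E''' : Representation k G (U''' × U')) (hE''' : ∀ g w u', E''' g (w, u') = (ρ''' g w + (e ∘ₗ c g) u', ρ' g u')) (g : G)
    (u : U) (u' : U') :
    E''' g (e u, u') = (e (E g (u, u')).1, (E g (u, u')).2) := by
  rw [hE, hE''']
  refine Prod.ext ?_ rfl
  have h := congrArg (fun T : U →ₗ[k] U''' => T u) (he g)
  simp only [LinearMap.comp_apply] at h
  dsimp only
  rw [map_add, h, LinearMap.comp_apply]

/-- Push-out takes coboundaries to coboundaries: `e ∘ (t ∘ ρ' g - ρ g ∘ t) = (e ∘ t) ∘ ρ' g - ρ''' g ∘ (e ∘ t)`.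
[cite: Brown1982, Ch. IV §2 p. 89] -/
theorem pushout_coboundary (ρ : Representation k G U) (ρ' : Representation k G U') (ρ''' : Representation k G U''')
    (t : U' →ₗ[k] U) (e : U →ₗ[k] U''') (he : ∀ g, e ∘ₗ ρ g = ρ''' g ∘ₗ e) (g : G) :
    e ∘ₗ (t ∘ₗ ρ' g - ρ g ∘ₗ t) = (e ∘ₗ t) ∘ₗ ρ' g - ρ''' g ∘ₗ (e ∘ₗ t) := by
  have h : e ∘ₗ (ρ g ∘ₗ t) = ρ''' g ∘ₗ (e ∘ₗ t) := by rw [← LinearMap.comp_assoc, he, LinearMap.comp_assoc]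
  rw [LinearMap.comp_sub, h]
  simp only [LinearMap.comp_assoc]

end Functorial

end Literature.RepresentationTheory
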